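import Summits.AtomisticToContinuum.BoseEinsteinCondensation.Theorems.BECPhaseQuadratureSumRuleCurrentSumRuleEngine

/-!
# Route `BECPhaseQuadratureSumRule`, support `CurrentSumRule` (stmt-AtomisticToContinuum-12618), III:
# complex amplitudes — real/imaginary splitting and the parallelogram bound for the shifted form

Supports stmt-AtomisticToContinuum-12618. A complex minimiser `Ψ = u₁ + iu₂` of the periodic
`N`-body energy is handled through its real and imaginary parts (both real solutions of the
Euler–Lagrange equation): this file supplies the book-keeping —

* `fderiv_eq_re_add_im`, `fderiv_fderiv_re/im`, `realEquation_re/im` — derivatives and the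
  eigenvalue equation of `Re Ψ`, `Im Ψ` from those of `Ψ`;
* `fderiv_fderiv_add_const_mul_apply` — second derivatives of `F + cG`;
* `form_add_le` — **the parallelogram bound** `q_W(φ + η) ≤ 2q_W(φ) + 2q_W(η)` for a shifted form
  `q_W(φ) = ∫(|∇φ|² + W|φ|²)` that is non-negative on the admissible (periodic, Bose-symmetric)
  class (Cauchy–Schwarz `b_W(η,φ)² ≤ q_W(φ)q_W(η)`), and `form_I_mul` (`q_W(iφ) = q_W(φ)`);
* `ofReal_four_mul` — the `ℝ≥0∞` packaging of the right-hand side of the sum rule.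

This is where the factor `4 = 2·2` of `CurrentSumRule` (`m₂² ≤ 4 m₁ M₃`) is spent:
`q(ρ_k Ψ) ≤ 2q(ρ_k u₁) + 2q(ρ_k u₂) = 2Nκ` and `q(A_kΨ) ≤ 2q(A_ku₁) + 2q(A_ku₂) ≤ 2M₃`.
References: S. Stringari, in *Bose–Einstein Condensation* (CUP 1995) §2 (after (8)), §2.3.
-/

noncomputable section

namespace Summit.AtomisticToContinuum.BoseEinsteinCondensation.Theorems

open MeasureTheory
open scoped ENNReal NNReal BigOperators ComplexConjugate
open Literature.MathematicalPhysics.QuantumManyBody.BoseGas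

namespace CurrentSumRule

variable {N : ℕ} {L : ℝ}

/-! ### Real and imaginary parts -/

/-- `z = Re z + i Im z`. [folklore] -/
theorem eq_re_add_I_mul_im (z : ℂ) : z = ((z.re : ℝ) : ℂ) + Complex.I * ((z.im : ℝ) : ℂ) := by
  rw [mul_comm]
  exact (Complex.re_add_im z).symm

section Parts

variable {ψ : Config N → ℂ}

/-- `DΨ·v = D(Re Ψ)·v + i D(Im Ψ)·v`. [folklore] -/
theorem fderiv_eq_re_add_im {X : Config N} (hψ : DifferentiableAt ℝ ψ X) (v : Config N) :
    fderiv ℝ ψ X v = ((fderiv ℝ (fun Y => (ψ Y).re) X v : ℝ) : ℂ) +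
      Complex.I * ((fderiv ℝ (fun Y => (ψ Y).im) X v : ℝ) : ℂ) := by
  rw [fderiv_re_apply hψ, fderiv_im_apply hψ]
  exact eq_re_add_I_mul_im _

/-- `|DΨ·v|² = (D(Re Ψ)·v)² + (D(Im Ψ)·v)²`. [folklore] -/
theorem norm_fderiv_sq_eq {X : Config N} (hψ : DifferentiableAt ℝ ψ X) (v : Config N) :
    ‖fderiv ℝ ψ X v‖ ^ 2 = fderiv ℝ (fun Y => (ψ Y).re) X v ^ 2 + fderiv ℝ (fun Y => (ψ Y).im) X v ^ 2 := by
  rw [Complex.sq_norm, Complex.normSq_apply, fderiv_re_apply hψ, fderiv_im_apply hψ]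
  ring

/-- Second derivatives of `Re Ψ` are real parts of second derivatives of `Ψ`. [folklore] -/
theorem fderiv_fderiv_re (hψ : ContDiff ℝ 2 ψ) (X v w : Config N) :
    fderiv ℝ (fun Y => fderiv ℝ (fun Z => (ψ Z).re) Y v) X w = (fderiv ℝ (fun Y => fderiv ℝ ψ Y v) X w).re := by
  have hd := hψ.differentiable two_ne_zero
  have h1 : (fun Y => fderiv ℝ (fun Z => (ψ Z).re) Y v) = fun Y => (fderiv ℝ ψ Y v).re :=
    funext fun Y => fderiv_re_apply (hd Y) v
  rw [h1, fderiv_re_apply (differentiable_fderiv_apply_const hψ v X)]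

/-- Second derivatives of `Im Ψ` are imaginary parts of second derivatives of `Ψ`. [folklore] -/
theorem fderiv_fderiv_im (hψ : ContDiff ℝ 2 ψ) (X v w : Config N) :
    fderiv ℝ (fun Y => fderiv ℝ (fun Z => (ψ Z).im) Y v) X w = (fderiv ℝ (fun Y => fderiv ℝ ψ Y v) X w).im := by
  have hd := hψ.differentiable two_ne_zero
  have h1 : (fun Y => fderiv ℝ (fun Z => (ψ Z).im) Y v) = fun Y => (fderiv ℝ ψ Y v).im :=
    funext fun Y => fderiv_im_apply (hd Y) v
  rw [h1, fderiv_im_apply (differentiable_fderiv_apply_const hψ v X)]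

variable {V : Config N → ℝ} {E : ℝ}

/-- **The eigenvalue equation for the real part**: if `-ΔΨ + VΨ = EΨ` pointwise (`V`, `E` real,
`Ψ ∈ C²`), then `-Δ(Re Ψ) + V Re Ψ = E Re Ψ`. [folklore] -/
theorem realEquation_re (hψ : ContDiff ℝ 2 ψ)
    (hEL : ∀ X : Config N, -(∑ i : Fin N, ∑ a : Fin 3,
        fderiv ℝ (fun Y : Config N => fderiv ℝ ψ Y (Pi.single i (EuclideanSpace.single a (1 : ℝ)))) X
          (Pi.single i (EuclideanSpace.single a (1 : ℝ)))) + ((V X : ℝ) : ℂ) * ψ X = ((E : ℝ) : ℂ) * ψ X)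
    (X : Config N) :
    -(∑ i : Fin N, ∑ a : Fin 3, fderiv ℝ (fun Y : Config N => fderiv ℝ (fun Z => (ψ Z).re) Y
        (Pi.single i (EuclideanSpace.single a (1 : ℝ)))) X (Pi.single i (EuclideanSpace.single a (1 : ℝ)))) +
      V X * (ψ X).re = E * (ψ X).re := by
  have h := congrArg Complex.re (hEL X)
  simp only [Complex.add_re, Complex.neg_re, Complex.re_sum, Complex.mul_re, Complex.ofReal_re,
    Complex.ofReal_im, zero_mul, sub_zero] at h
  simp_rw [fderiv_fderiv_re hψ]
  exact h

/-- **The eigenvalue equation for the imaginary part**: `-Δ(Im Ψ) + V Im Ψ = E Im Ψ`. [folklore] -/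
theorem realEquation_im (hψ : ContDiff ℝ 2 ψ)
    (hEL : ∀ X : Config N, -(∑ i : Fin N, ∑ a : Fin 3,
        fderiv ℝ (fun Y : Config N => fderiv ℝ ψ Y (Pi.single i (EuclideanSpace.single a (1 : ℝ)))) X
          (Pi.single i (EuclideanSpace.single a (1 : ℝ)))) + ((V X : ℝ) : ℂ) * ψ X = ((E : ℝ) : ℂ) * ψ X)
    (X : Config N) :
    -(∑ i : Fin N, ∑ a : Fin 3, fderiv ℝ (fun Y : Config N => fderiv ℝ (fun Z => (ψ Z).im) Y
        (Pi.single i (EuclideanSpace.single a (1 : ℝ)))) X (Pi.single i (EuclideanSpace.single a (1 : ℝ)))) +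
      V X * (ψ X).im = E * (ψ X).im := by
  have h := congrArg Complex.im (hEL X)
  simp only [Complex.add_im, Complex.neg_im, Complex.im_sum, Complex.mul_im, Complex.ofReal_re,
    Complex.ofReal_im, zero_mul, add_zero] at h
  simp_rw [fderiv_fderiv_im hψ]
  exact h

end Parts

/-! ### Second derivatives of `F + cG` -/

/-- `∂_v∂_u(F + cG) = ∂_v∂_uF + c ∂_v∂_uG` for `C²` complex amplitudes. [folklore] -/
theorem fderiv_fderiv_add_const_mul_apply {F G : Config N → ℂ} (hF : ContDiff ℝ 2 F) (hG : ContDiff ℝ 2 G)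
    (c : ℂ) (X u v : Config N) :
    fderiv ℝ (fun Y => fderiv ℝ (fun Z => F Z + c * G Z) Y u) X v =
      fderiv ℝ (fun Y => fderiv ℝ F Y u) X v + c * fderiv ℝ (fun Y => fderiv ℝ G Y u) X v := by
  have hFd := hF.differentiable two_ne_zero
  have hGd := hG.differentiable two_ne_zero
  have h1 : (fun Y => fderiv ℝ (fun Z => F Z + c * G Z) Y u) = fun Y => fderiv ℝ F Y u + c * fderiv ℝ G Y u := by
    funext Y
    rw [fderiv_add_apply' (hFd Y) ((hGd Y).const_mul c), fderiv_const_mul_apply' (hGd Y)]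
  rw [h1, fderiv_add_apply' (differentiable_fderiv_apply_const hF u X)
      ((differentiable_fderiv_apply_const hG u X).const_mul c),
    fderiv_const_mul_apply' (differentiable_fderiv_apply_const hG u X)]

/-! ### The parallelogram bound for a non-negative shifted form -/

/-- `|∇(iφ)|² = |∇φ|²` pointwise. [folklore] -/
theorem kineticDensityReal_I_mul {φ : Config N → ℂ} {X : Config N} (hφ : DifferentiableAt ℝ φ X) :
    kineticDensityReal (fun Y => Complex.I * φ Y) X = kineticDensityReal φ X := by
  unfold kineticDensityReal
  refine Finset.sum_congr rfl fun i _ => Finset.sum_congr rfl fun a _ => ?_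
  rw [fderiv_const_mul_apply' hφ, norm_mul, Complex.norm_I, one_mul]

/-- `q_W(iφ) = q_W(φ)`. [folklore] -/
theorem form_I_mul (W : Config N → ℝ) {φ : Config N → ℂ} (hφ : Differentiable ℝ φ) (L : ℝ) :
    ∫ X in cellN N L, (kineticDensityReal (fun Y => Complex.I * φ Y) X + W X * ‖Complex.I * φ X‖ ^ 2) =
      ∫ X in cellN N L, (kineticDensityReal φ X + W X * ‖φ X‖ ^ 2) := by
  refine integral_congr_ae (ae_of_all _ fun X => ?_)
  dsimp only
  rw [kineticDensityReal_I_mul (hφ X), norm_mul, Complex.norm_I, one_mul]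

/-- **The parallelogram bound.** If the shifted form `q_W(ψ) = ∫ (|∇ψ|² + W|ψ|²)` (continuous real
weight `W`) is non-negative on the `C¹`, lattice-periodic, Bose-symmetric amplitudes, then for
`φ, η` in that class `q_W(φ + η) ≤ 2 q_W(φ) + 2 q_W(η)` (from `q_W(φ+η) = q_W(φ) + 2b_W(η,φ) + q_W(η)`
and Cauchy–Schwarz `b_W² ≤ q_W(φ)q_W(η)`). [cite: Stringari1995, §2 (after (8))] -/
theorem form_add_le {W : Config N → ℝ} (hW : Continuous W)
    (hnonneg : ∀ ψ : Config N → ℂ, ContDiff ℝ 1 ψ →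
      (∀ (X : Config N) (i : Fin N) (c : Fin 3), ψ (X + Pi.single i (EuclideanSpace.single c L)) = ψ X) →
      (∀ (σ : Equiv.Perm (Fin N)) (X : Config N), ψ (X ∘ σ) = ψ X) →
      0 ≤ ∫ X in cellN N L, (kineticDensityReal ψ X + W X * ‖ψ X‖ ^ 2))
    {φ η : Config N → ℂ} (hφ : ContDiff ℝ 1 φ) (hη : ContDiff ℝ 1 η)
    (hφper : ∀ (X : Config N) (i : Fin N) (c : Fin 3),
      φ (X + Pi.single i (EuclideanSpace.single c L)) = φ X)
    (hηper : ∀ (X : Config N) (i : Fin N) (c : Fin 3),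
      η (X + Pi.single i (EuclideanSpace.single c L)) = η X)
    (hφsymm : ∀ (σ : Equiv.Perm (Fin N)) (X : Config N), φ (X ∘ σ) = φ X)
    (hηsymm : ∀ (σ : Equiv.Perm (Fin N)) (X : Config N), η (X ∘ σ) = η X) :
    ∫ X in cellN N L, (kineticDensityReal (fun Y => φ Y + η Y) X + W X * ‖φ X + η X‖ ^ 2) ≤
      2 * (∫ X in cellN N L, (kineticDensityReal φ X + W X * ‖φ X‖ ^ 2)) +
        2 * ∫ X in cellN N L, (kineticDensityReal η X + W X * ‖η X‖ ^ 2) := by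
  have hexp := integral_form_weight_add_mul hW hφ hη 1 L
  simp only [Complex.ofReal_one, one_mul, one_pow, mul_one] at hexp
  have hcs := sq_formPairing_le_of_nonneg hW hnonneg hφ hη hφper hηper hφsymm hηsymm
  have hqφ := hnonneg φ hφ hφper hφsymm
  have hqη := hnonneg η hη hηper hηsymm
  rw [hexp]
  nlinarith [hcs, hqφ, hqη, sq_nonneg ((∫ X in cellN N L, (kineticDensityReal φ X + W X * ‖φ X‖ ^ 2)) -
    ∫ X in cellN N L, (kineticDensityReal η X + W X * ‖η X‖ ^ 2))]

/-! ### `ℝ≥0∞` packaging -/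

/-- The right-hand side of the sum rule in `ℝ≥0∞`:
`ofReal(4a(bc + d + 4e)) = 4(ofReal a (ofReal b · ofReal c + ofReal d + 4 ofReal e))` for
non-negative reals. [folklore] -/
theorem ofReal_four_mul (a b c d e : ℝ) (ha : 0 ≤ a) (hb : 0 ≤ b) (hc : 0 ≤ c) (hd : 0 ≤ d) (he : 0 ≤ e) :
    ENNReal.ofReal (4 * (a * (b * c + d + 4 * e))) =
      4 * (ENNReal.ofReal a * (ENNReal.ofReal b * ENNReal.ofReal c + ENNReal.ofReal d + 4 * ENNReal.ofReal e)) := by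
  have h4 : (0 : ℝ) ≤ 4 := by norm_num
  rw [ENNReal.ofReal_mul h4, ENNReal.ofReal_mul ha, ENNReal.ofReal_add (by positivity) (by positivity),
    ENNReal.ofReal_add (by positivity) hd, ENNReal.ofReal_mul hb, ENNReal.ofReal_mul h4, ENNReal.ofReal_ofNat]

end CurrentSumRule

end Summit.AtomisticToContinuum.BoseEinsteinCondensation.Theorems

end
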